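import Summits.QuantumFields.BalabanUV.Beta.D1BFx.NeedlePotentialProfile
import Summits.QuantumFields.BalabanUV.Beta.D1BFx.LatticeHLS

/-!
# `BalabanUV.Beta.D1BFx.NeedlePotentialPhi` — road «BF-x» for binder row D1, slot (K), END row `hGrp gN`, «GN-L3-Φ»: THE Φ-LETTERS OF THE NEEDLE POTENTIAL —
# over gan24-leaf-05-g41's thin-needle profile (`NeedlePotentialProfile`, PART 2f: `|ndlRow n a κ′ u x| ≤ Σ_{s∈B(blk u)} |qJet_s|·(kV∕n²)∕nrm(x−s)²`, a superposition of Coulomb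
# profiles centred on the needle sites, and its d1 twin `kP∕nrm³`) — their convolutions with a Coulomb kernel profile `κ₁∕nrm³` ∕ `κ₀∕nrm²`
# through leaf-04-g9's sharp lattice HLS: `Σ_{x′} κ₁∕nrm(y−x′)³·|ndlRow(x′)| ≤ κ₁·(kV∕n²)·C₄·Σ_s |qJet_s|∕nrm(y−s)` (an3-g57 §3′ (2): «`Φ_u(x) := Σ_{x′}|∇Ga(x,x′)|·|row_u(x′)| ≤
# k·n⁻⁶·Σ_{s∈𝒩_u} nrm(x−s)⁻¹`», the letter the R3 cells of T₃ need for the THIN needles κ′ ≤ 2)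

HONEST DEPENDENCY (cell records, verbatim): «continuum YM on T⁴ ⇐ BetaPertH ∧ nine spine estimates (0/9 proved); BetaPertH ⇐ (D1) ∧ (D4) ∧
CAP+tail; G-an2-4 gates asym, D1 and NE2/3/4.»  HONEST FRAMING (cell contract, verbatim): «discharging `BetaPertH` makes Bałaban's UV stability
UNCONDITIONAL — a real constructive-QFT result; it is NOT the continuum limit and NOT the Clay problem.»  THIS MODULE DISCHARGES NOTHING of the
wall: [folklore] bookkeeping BY NAME over gan24-leaf-05-g41's `NeedlePotentialProfile.abs_ndlRow_le_needle_inv_sq` ∕ `abs_ndlRow_diff_le_needle_inv_cube`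
(PART 2f, hypothesis-free, over `RColumnProfile` (P3)∕(P4)) and leaf-04-g9's sharp two-centre HLS
`LatticeHLS.sum_inv_nrm_pow_mul_le`.  No `def`, no `def … : Prop`, nothing cited, no printed statement used, 0 sorry.  Root-level binders hW ∕ hR-sockets ∕
hSX-socket ∕ D1Tel ∕ D1Rep — 0 discharged; (K) NOT closed; NOT D1, NOT `BetaPertH`, NOT continuum, NOT Clay.

ABSOLUTE RULE (cell charter, verbatim): «No internally-minted statement may enter as a cited fact. Every hypothesis is either kernel-proved in
this package or a verbatim quotation of a PUBLISHED theorem with page reference. The manuscript(s) under audit are NOT citable for their own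
disputed steps — they are the thing under adjudication; programme-internal (2001/route/tribunal) claims are never citable.»

WHY (owner claim table «GN-CELLS» = `GLUON-NEEDLE-ROWS.md` v0.2: the five R3 cells PQ∕QP∕KQ∕QK∕QQ of T₃ and the Q̇-piece of T₁∕T₂; an3-g57 §3′ (4) R1⊗R3:
«`(Ga∇row)(u′,μ) = −Σ_x ∇Ga(u′;x)·row(x)` ≤ Φ_b(u′) ≤ k n^{λ−6} (the profile letter is REQUIRED here: `sup|∇Ga|·m_row = k n^{λ−3}` is n³ short)»).  PART 2c gives the
needle potential's SUP and MASS letters (`n⁻⁴·cR·e`, `w·cR·K`), saturated at κ′ = 3; for the thin needles the near-block placements need the PROFILE: each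
needle site `s` contributes a Coulomb profile `(kV∕n²)·|qJet_s|∕nrm(x−s)²`, and a Coulomb kernel of degree 3 (the d1 row of the gluon leg, «GN-L1-PROFILE-D1»)
convolved with it reproduces degree 1 about `s` by the sharp HLS count (3,2) ↦ 1 — summed over the ≤ `n^{κ′+1}` needle sites with weights `n⁻⁴`.

CONTENT (`a > 0`, `n ≥ 1`; `B = B (n−1)`, `blk = blk (n−1)`; all sums uniform over finite sets `S`).
* §1 [folklore] `abs_ndlRow_le_profile`, `abs_ndlRow_diff_le_profile` — PART 2f's profiles with the constant outside the needle sum (one `Finset.mul_sum`).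
* §2 [folklore] the Φ-letters: **`sum_inv_cube_mul_abs_ndlRow_le`** (`Σ_{x′∈S} κ₁∕nrm(x′−y)³·|ndlRow x′| ≤ κ₁·(kV∕n²)·C₄·Σ_s |qJet s|∕nrm(y−s)`, `C₄ = 4·2⁷·9³`),
  **`sum_inv_sq_mul_abs_ndlRow_diff_le`** (`Σ_{x′∈S} κ₀∕nrm(x′−y)²·|∇_ρ ndlRow x′| ≤ κ₀·(kP∕n²)·C₄·Σ_s |qJet s|∕nrm(y−s)`).
* §3 [folklore] the needle-site weights for the census: `sum_abs_qJet_div_nrm_le_weight` (`Σ_s |qJet s|∕nrm(y−s) ≤ Σ_s |qJet s| ≤ n^{κ′+1}·n⁻⁴`, the crude form) — the cell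
  author refines by the geometry of the needle where needed.
NOT HERE (honest): any cell of T₃; the (1.22) sums.
Unit `b2b-balaban-beta-d1-p2` (gen 10), road «BF-x» OWNER; `LEAVES-BFx.md` row (N) «GN-L3-Φ».
-/

namespace Summit.QuantumFields.BalabanUV.Beta.D1BFx.NeedlePotentialPhi

open Finset
open scoped BigOperators
open Literature.MathematicalPhysics.QuantumFieldTheory.Balaban1983to89
open Literature.MathematicalPhysics.QuantumFieldTheory.Balaban1983to89.Beta
open B6QGQLower276 (X blk B mem_B)
open Beta.PoissonInterior (nrm one_le_nrm nrm_pos)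
open AffineAveraging (unitVec)
open Summit.QuantumFields.BalabanUV.Beta.D1BFx.RProjector (Pgt)
open Summit.QuantumFields.BalabanUV.Beta.D1BFx.GhostLeg (Ggh)
open Summit.QuantumFields.BalabanUV.Beta.D1BFx.GhostStencil (qJet)
open Summit.QuantumFields.BalabanUV.Beta.D1BFx.AveragingJetNeedle (sum_B_abs_qJet_le)
open Summit.QuantumFields.BalabanUV.Beta.D1BFx.RProjectorJet (RG)
open Summit.QuantumFields.BalabanUV.Beta.D1BFx.RColumnProfile (kV kP kV_nonneg_and)
open Summit.QuantumFields.BalabanUV.Beta.D1BFx.NeedlePotentialLetters (ndlRow)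
open Summit.QuantumFields.BalabanUV.Beta.D1BFx.NeedlePotentialProfile (abs_ndlRow_le_needle_inv_sq abs_ndlRow_diff_le_needle_inv_cube)
open Summit.QuantumFields.BalabanUV.Beta.D1BFx.LatticeHLS (sum_inv_nrm_pow_mul_le)

noncomputable section

variable (n : ℕ) [NeZero n] {a : ℝ} (κ' : Fin 4) (u : X 4)

/-! ## §1 PART 2f's profiles, constant outside -/

/-- [folklore] PART 2f's value profile with the constant outside the needle sum: `|ndlRow x| ≤ kV a∕n² · Σ_{s ∈ B(blk u)} |qJet s| ∕ nrm (x − s)²`. -/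
theorem abs_ndlRow_le_profile (ha : 0 < a) (x : X 4) :
    |ndlRow n a κ' u x| ≤ kV a / (n : ℝ) ^ 2 * ∑ s ∈ B (n - 1) (blk (n - 1) u), |qJet n κ' u (blk (n - 1) u) s| / nrm (x - s) ^ 2 := by
  refine (abs_ndlRow_le_needle_inv_sq n κ' u ha x).trans (le_of_eq ?_)
  rw [Finset.mul_sum]
  exact Finset.sum_congr rfl fun s _ => by have := nrm_pos (x - s); field_simp

/-- [folklore] PART 2f's d1 profile with the constant outside: `|ndlRow (x + e_ρ) − ndlRow x| ≤ kP a∕n² · Σ_{s ∈ B(blk u)} |qJet s| ∕ nrm (x − s)³`. -/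
theorem abs_ndlRow_diff_le_profile (ha : 0 < a) (x : X 4) (ρ : Fin 4) :
    |ndlRow n a κ' u (x + unitVec ρ) - ndlRow n a κ' u x|
      ≤ kP a / (n : ℝ) ^ 2 * ∑ s ∈ B (n - 1) (blk (n - 1) u), |qJet n κ' u (blk (n - 1) u) s| / nrm (x - s) ^ 3 := by
  refine (abs_ndlRow_diff_le_needle_inv_cube n κ' u ha x ρ).trans (le_of_eq ?_)
  rw [Finset.mul_sum]
  exact Finset.sum_congr rfl fun s _ => by have := nrm_pos (x - s); field_simp

/-! ## §2 The Φ-letters: a Coulomb kernel profile convolved with the needle potential, through the sharp HLS -/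

/-- [folklore] the one-line form of the sharp two-centre HLS on `ℤ⁴` for the pairs `(3,2)` and `(2,3)`: `Σ_{x∈S} 1∕(nrm(x−y)^a·nrm(x−s)^b) ≤ C₄∕nrm(y−s)`,
`C₄ = 4·2⁷·9³`, whenever `(a,b) ∈ {(3,2),(2,3)}`. -/
theorem hls32 (S : Finset (X 4)) (y s : X 4) :
    ∑ x ∈ S, 1 / (nrm (x - y) ^ 3 * nrm (x - s) ^ 2) ≤ 4 * 2 ^ (4 + 3) * 9 ^ (4 - 1) / nrm (y - s) ^ 1 := by
  have h := sum_inv_nrm_pow_mul_le (d := 4) (by norm_num) (a := 3) (b := 2) (by norm_num) (by norm_num) (by norm_num) S y s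
  simpa using h

/-- [folklore] the `(2,3)` twin of `hls32`. -/
theorem hls23 (S : Finset (X 4)) (y s : X 4) :
    ∑ x ∈ S, 1 / (nrm (x - y) ^ 2 * nrm (x - s) ^ 3) ≤ 4 * 2 ^ (4 + 3) * 9 ^ (4 - 1) / nrm (y - s) ^ 1 := by
  have h := sum_inv_nrm_pow_mul_le (d := 4) (by norm_num) (a := 2) (b := 3) (by norm_num) (by norm_num) (by norm_num) S y s
  simpa using h

/-- [folklore] **Φ-LETTER (degree-3 kernel against the value profile)**: for `κ₁ ≥ 0` and any finite `S`,
`Σ_{x′∈S} κ₁∕nrm(x′−y)³ · |ndlRow n a κ′ u x′| ≤ κ₁·(kV a∕n²)·C₄·Σ_{s∈B(blk u)} |qJet s|∕nrm(y−s)` — the d1 row of a Coulomb leg against the needle potential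
reproduces a degree-1 profile about every needle site (an3 §3′ (2) `Φ_u`). -/
theorem sum_inv_cube_mul_abs_ndlRow_le (ha : 0 < a) {κ₁ : ℝ} (hκ₁ : 0 ≤ κ₁) (S : Finset (X 4)) (y : X 4) :
    ∑ x' ∈ S, κ₁ / nrm (x' - y) ^ 3 * |ndlRow n a κ' u x'|
      ≤ κ₁ * (kV a / (n : ℝ) ^ 2) * (4 * 2 ^ (4 + 3) * 9 ^ (4 - 1)) *
        ∑ s ∈ B (n - 1) (blk (n - 1) u), |qJet n κ' u (blk (n - 1) u) s| / nrm (y - s) ^ 1 := by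
  have hn : (0 : ℝ) < n := by exact_mod_cast Nat.pos_of_ne_zero (NeZero.ne n)
  have hkV : 0 ≤ kV a / (n : ℝ) ^ 2 := div_nonneg (kV_nonneg_and ha).1 (pow_pos hn 2).le
  -- insert the profile and swap the sums
  calc ∑ x' ∈ S, κ₁ / nrm (x' - y) ^ 3 * |ndlRow n a κ' u x'|
      ≤ ∑ x' ∈ S, κ₁ / nrm (x' - y) ^ 3 * (kV a / (n : ℝ) ^ 2 * ∑ s ∈ B (n - 1) (blk (n - 1) u), |qJet n κ' u (blk (n - 1) u) s| / nrm (x' - s) ^ 2) :=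
        Finset.sum_le_sum fun x' _ => mul_le_mul_of_nonneg_left (abs_ndlRow_le_profile n κ' u ha x')
          (div_nonneg hκ₁ (pow_pos (nrm_pos _) 3).le)
    _ = ∑ x' ∈ S, ∑ s ∈ B (n - 1) (blk (n - 1) u), κ₁ * (kV a / (n : ℝ) ^ 2) * (|qJet n κ' u (blk (n - 1) u) s| *
          (1 / (nrm (x' - y) ^ 3 * nrm (x' - s) ^ 2))) := by
        refine Finset.sum_congr rfl fun x' _ => ?_
        rw [Finset.mul_sum, Finset.mul_sum]
        refine Finset.sum_congr rfl fun s _ => ?_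
        have h1 := nrm_pos (x' - y); have h2 := nrm_pos (x' - s)
        field_simp
    _ = κ₁ * (kV a / (n : ℝ) ^ 2) * ∑ s ∈ B (n - 1) (blk (n - 1) u), |qJet n κ' u (blk (n - 1) u) s| *
          ∑ x' ∈ S, 1 / (nrm (x' - y) ^ 3 * nrm (x' - s) ^ 2) := by
        rw [Finset.sum_comm, Finset.mul_sum]
        refine Finset.sum_congr rfl fun s _ => ?_
        rw [Finset.mul_sum, Finset.mul_sum]
    _ ≤ κ₁ * (kV a / (n : ℝ) ^ 2) * ∑ s ∈ B (n - 1) (blk (n - 1) u), |qJet n κ' u (blk (n - 1) u) s| *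
          (4 * 2 ^ (4 + 3) * 9 ^ (4 - 1) / nrm (y - s) ^ 1) := by
        refine mul_le_mul_of_nonneg_left (Finset.sum_le_sum fun s _ => mul_le_mul_of_nonneg_left (hls32 S y s) (abs_nonneg _)) (by positivity)
    _ = _ := by
        rw [Finset.mul_sum, Finset.mul_sum]
        refine Finset.sum_congr rfl fun s _ => ?_
        have h2 := nrm_pos (y - s)
        field_simp

/-- [folklore] **Φ-LETTER, d1 TWIN (degree-2 kernel against the d1 profile)**: for `κ₀ ≥ 0`,
`Σ_{x′∈S} κ₀∕nrm(x′−y)² · |ndlRow (x′+e_ρ) − ndlRow x′| ≤ κ₀·(kP a∕n²)·C₄·Σ_{s∈B(blk u)} |qJet s|∕nrm(y−s)`. -/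
theorem sum_inv_sq_mul_abs_ndlRow_diff_le (ha : 0 < a) {κ₀ : ℝ} (hκ₀ : 0 ≤ κ₀) (S : Finset (X 4)) (y : X 4) (ρ : Fin 4) :
    ∑ x' ∈ S, κ₀ / nrm (x' - y) ^ 2 * |ndlRow n a κ' u (x' + unitVec ρ) - ndlRow n a κ' u x'|
      ≤ κ₀ * (kP a / (n : ℝ) ^ 2) * (4 * 2 ^ (4 + 3) * 9 ^ (4 - 1)) *
        ∑ s ∈ B (n - 1) (blk (n - 1) u), |qJet n κ' u (blk (n - 1) u) s| / nrm (y - s) ^ 1 := by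
  have hn : (0 : ℝ) < n := by exact_mod_cast Nat.pos_of_ne_zero (NeZero.ne n)
  have hkP : 0 ≤ kP a / (n : ℝ) ^ 2 := div_nonneg (kV_nonneg_and ha).2 (pow_pos hn 2).le
  calc ∑ x' ∈ S, κ₀ / nrm (x' - y) ^ 2 * |ndlRow n a κ' u (x' + unitVec ρ) - ndlRow n a κ' u x'|
      ≤ ∑ x' ∈ S, κ₀ / nrm (x' - y) ^ 2 * (kP a / (n : ℝ) ^ 2 * ∑ s ∈ B (n - 1) (blk (n - 1) u), |qJet n κ' u (blk (n - 1) u) s| / nrm (x' - s) ^ 3) :=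
        Finset.sum_le_sum fun x' _ => mul_le_mul_of_nonneg_left (abs_ndlRow_diff_le_profile n κ' u ha x' ρ)
          (div_nonneg hκ₀ (pow_pos (nrm_pos _) 2).le)
    _ = ∑ x' ∈ S, ∑ s ∈ B (n - 1) (blk (n - 1) u), κ₀ * (kP a / (n : ℝ) ^ 2) * (|qJet n κ' u (blk (n - 1) u) s| *
          (1 / (nrm (x' - y) ^ 2 * nrm (x' - s) ^ 3))) := by
        refine Finset.sum_congr rfl fun x' _ => ?_
        rw [Finset.mul_sum, Finset.mul_sum]
        refine Finset.sum_congr rfl fun s _ => ?_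
        have h1 := nrm_pos (x' - y); have h2 := nrm_pos (x' - s)
        field_simp
    _ = κ₀ * (kP a / (n : ℝ) ^ 2) * ∑ s ∈ B (n - 1) (blk (n - 1) u), |qJet n κ' u (blk (n - 1) u) s| *
          ∑ x' ∈ S, 1 / (nrm (x' - y) ^ 2 * nrm (x' - s) ^ 3) := by
        rw [Finset.sum_comm, Finset.mul_sum]
        refine Finset.sum_congr rfl fun s _ => ?_
        rw [Finset.mul_sum, Finset.mul_sum]
    _ ≤ κ₀ * (kP a / (n : ℝ) ^ 2) * ∑ s ∈ B (n - 1) (blk (n - 1) u), |qJet n κ' u (blk (n - 1) u) s| *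
          (4 * 2 ^ (4 + 3) * 9 ^ (4 - 1) / nrm (y - s) ^ 1) := by
        refine mul_le_mul_of_nonneg_left (Finset.sum_le_sum fun s _ => mul_le_mul_of_nonneg_left (hls23 S y s) (abs_nonneg _)) (by positivity)
    _ = _ := by
        rw [Finset.mul_sum, Finset.mul_sum]
        refine Finset.sum_congr rfl fun s _ => ?_
        have h2 := nrm_pos (y - s)
        field_simp

/-! ## §3 The crude needle-site weight -/

/-- [folklore] the crude form of the needle-site weight: `Σ_{s∈B(blk u)} |qJet s|∕nrm(y−s) ≤ Σ_s |qJet s| ≤ n^{κ′+1}·n⁻⁴` (`nrm ≥ 1`; `AveragingJetNeedle.sum_B_abs_qJet_le`). -/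
theorem sum_abs_qJet_div_nrm_le_weight (y : X 4) :
    ∑ s ∈ B (n - 1) (blk (n - 1) u), |qJet n κ' u (blk (n - 1) u) s| / nrm (y - s) ^ 1 ≤ (n : ℝ) ^ ((κ' : ℕ) + 1) * ((n : ℝ) ^ 4)⁻¹ := by
  refine (Finset.sum_le_sum fun s _ => ?_).trans (sum_B_abs_qJet_le n κ' u (blk (n - 1) u))
  rw [pow_one]
  exact div_le_self (abs_nonneg _) (one_le_nrm _)

end

end Summit.QuantumFields.BalabanUV.Beta.D1BFx.NeedlePotentialPhi
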